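import Summits.QuantumFields.GaugeBoot.OrbitAverageOperator
import Summits.QuantumFields.GaugeBoot.GaugeOrbitPolynomials
import HarnessLib

/-!
# The non-abelian lattice bootstrap on gauge-invariant data is exact in finite volume (gauge-boot, L1 supplement)

HONEST FRAMING (cell `pub-gaugeboot`, page 1 of every file): the venture produces certified bounds
on lattice expectations at stated coupling, gauge group, dimension and torus size; NOT a mass gap,
NOT a continuum limit, NOT a string tension; NOT Yang–Mills-summit-bearing (barriers
`FixedCouplingUltralocality`, `PerturbativeInvisibility`). Structural; it certifies no number.

## Content

`BootstrapFunctionals.lean` (lean3 gen 74) states the untruncated bootstrap with ALL polynomial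
observables as unknowns (open strings included). An actual non-abelian lattice bootstrap
(Anderson–Kruczenski 2017; Kazakov–Zheng 2022, 2024) has as unknowns only GAUGE-INVARIANT data —
(multi-trace) Wilson loops — and two kinds of constraints: positive semi-definiteness of matrices
of Wilson loops (inner products of open Wilson LINES with the open indices contracted:
Kazakov–Zheng 2024 §3.1, "Hermitian-conjugation positivity" with multi-index operators) and the
finite-`N` multi-trace Makeenko–Migdal loop equations (Kazakov–Zheng 2024 §2.3: the variation of
`W[C]_{ab} ∏ W[C_i] e^{-S}` under a one-link shift, indices contracted). Both are images under the
GAUGE AVERAGE `A = gaugeAvgL` (`OrbitAverageOperator.avgL` for the gauge group) of the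
all-polynomial constraints; for a functional `ψ` on gauge-invariant data:
(P_G) `0 ≤ ψ (A (a a))` for every polynomial (open-string) `a`;
(SD_G) `ψ (A f') = β ψ (A (f S_i'))` for every polynomial test function `f`, i.e.
`IsSDFunctional … (ψ ∘ₗ A)` (`isSDFunctional_comp_iff`).

* ★★★ `eq_wilson_of_gaugeInvariantBootstrap_suN` / `_uN` — `SU(N)` / `U(N)` on `(ℤ/L)^d`, ANY
  real `β`: `ψ 1 = 1`, (P_G), (SD_G) give EVERY gauge-invariant polynomial observable its Wilson
  expectation; indeed the gauge-invariant extension `ψ ∘ₗ A` IS the Wilson expectation on all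
  polynomials (`comp_gaugeAvgL_eq_wilson_suN`); conversely (`gaugeInvariantBootstrap_wilson_suN`);
* ★★ `isSDFunctional_comp_gaugeAvgL_iff`, `sqPositive_comp_gaugeAvgL_iff` — for a GAUGE-INVARIANT
  functional, (SD_G) ⇔ (SD) and (P_G) ⇔ (P): the bootstrap on gauge-invariant data is the
  all-polynomial bootstrap restricted to gauge-invariant functionals (nothing lost: the solution is
  gauge invariant);
* ★★ `exists_dlr_of_gaugeInvariantBootstrap_suN` / `_uN` — `ℤ^d`: solutions are DLR on the
  gauge-invariant polynomials.

What this is NOT: the evaluation of `A f'`, `A (f S')`, `A (a a)` on monomials as explicit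
polynomials in traced loops (Weingarten / invariant theory, Kazakov–Zheng's printed form) is not
formalised; no SINGLE-trace closure (large `N`, `SU(2)` trace identities); truncations:
`GaugeInvariantBootstrapConvergence.lean`; no rates.

References: P. Anderson, M. Kruczenski, Nucl. Phys. B 921 (2017) §3; V. Kazakov, Z. Zheng,
arXiv:2203.11360 §2–3; arXiv:2404.16925 (JHEP 03 (2025) 099) §2.3, §3.1. Folklore (no printed
completeness statement was found).
-/

noncomputable section

open MeasureTheory Filter Topology NormedSpace
open Literature.MathematicalPhysics.QuantumFieldTheory (haarProbability LatticeRep)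

namespace Summit.QuantumFields.GaugeBoot

/-! ## Rows of a composed functional, and congruence of the rows on the polynomials -/

section General

variable {ι : Type*} [DecidableEq ι] [Countable ι] {G : Type*} [Group G] [TopologicalSpace G]
  [IsTopologicalGroup G] [CompactSpace G] [MeasurableSpace G] [BorelSpace G]
  [SecondCountableTopology G] (r : LatticeRep G) {K : Type*} {k : K → ℝ → G}
  {S : ι → (ι → G) → ℝ} {β : ℝ}

omit [Countable ι] [IsTopologicalGroup G] [CompactSpace G] [MeasurableSpace G] [BorelSpace G]
  [SecondCountableTopology G] in
/-- **The loop equations of `ψ ∘ₗ A` unfolded**: `ψ (A f') = β ψ (A (f S_i'))` for every polynomial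
test function `f` (for `A` the gauge average: the index-contracted, multi-trace loop equations). -/
theorem isSDFunctional_comp_iff (A : C(ι → G, ℝ) →ₗ[ℝ] C(ι → G, ℝ)) (ψ : C(ι → G, ℝ) →ₗ[ℝ] ℝ) :
    IsSDFunctional r k S β (ψ ∘ₗ A) ↔
      ∀ (i : ι) (a : K), ∃ S' ∈ polyAlgebra (ι := ι) r,
        (∀ U, HasDerivAt (fun t => S i (Function.update U i (k a t * U i))) (S' U) 0) ∧
          ∀ f ∈ polyAlgebra (ι := ι) r, ∀ f' ∈ polyAlgebra (ι := ι) r,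
            (∀ U, HasDerivAt (fun t => f (Function.update U i (k a t * U i))) (f' U) 0) →
              ψ (A f') = β * ψ (A (f * S')) :=
  Iff.rfl

omit [Countable ι] [IsTopologicalGroup G] [CompactSpace G] [MeasurableSpace G] [BorelSpace G]
  [SecondCountableTopology G] in
/-- **The rows only involve polynomial values**: two functionals agreeing on the polynomial
observables are Schwinger–Dyson functionals together. -/
theorem isSDFunctional_congr {φ₁ φ₂ : C(ι → G, ℝ) →ₗ[ℝ] ℝ}
    (h : ∀ a ∈ polyAlgebra (ι := ι) r, φ₁ a = φ₂ a) :
    IsSDFunctional r k S β φ₁ ↔ IsSDFunctional r k S β φ₂ := by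
  refine forall_congr' fun i => forall_congr' fun a => exists_congr fun S' => and_congr_right
    fun hS'm => and_congr_right fun _ => forall_congr' fun f => forall_congr' fun hf =>
    forall_congr' fun f' => forall_congr' fun hf'm => forall_congr' fun _ => ?_
  rw [h f' hf'm, h (f * S') ((polyAlgebra (ι := ι) r).mul_mem hf hS'm)]

end General

/-! ## The gauge average on the torus -/

section Torus

open Literature.MathematicalPhysics.QuantumFieldTheory (Site Edge GaugeConfig gaugeTransform
  IsGaugeInvariant wilsonMeasure wilsonMeasure_map_gaugeTransform_holds)

variable (d L : ℕ) (G : Type*) [Group G] [TopologicalSpace G] [IsTopologicalGroup G]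
  [CompactSpace G] [MeasurableSpace G] [BorelSpace G] [SecondCountableTopology G] [NeZero L]

/-- **The gauge average** `(A f)(U) = ∫ f(U^g) dg` over the gauge group `(ℤ/L)^d → G` (product Haar
probability), as a linear self-map of the observables of the torus. [folklore] -/
def gaugeAvgL : C(GaugeConfig d L G, ℝ) →ₗ[ℝ] C(GaugeConfig d L G, ℝ) :=
  avgL (gaugeTransform (d := d) (L := L) (G := G)) gaugeTransform_action.2

/-- The gauge transformation `U ↦ U^g` as a continuous self-map of the configurations. [folklore] -/
def gaugeTransformCM (g : Site d L → G) : C(GaugeConfig d L G, GaugeConfig d L G) :=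
  actCM (gaugeTransform (d := d) (L := L) (G := G)) gaugeTransform_action.2 g

variable {d L G}

omit [CompactSpace G] [MeasurableSpace G] [BorelSpace G] [SecondCountableTopology G] [NeZero L] in
/-- `gaugeTransformCM` evaluated. -/
@[simp] theorem gaugeTransformCM_apply (g : Site d L → G) (U : GaugeConfig d L G) :
    gaugeTransformCM d L G g U = gaugeTransform g U := rfl

/-- **`gaugeAvgL` evaluated**: `(A f)(U) = ∫ f(U^g) dg`. -/
theorem gaugeAvgL_apply (f : C(GaugeConfig d L G, ℝ)) (U : GaugeConfig d L G) :
    gaugeAvgL d L G f U = ∫ g, f (gaugeTransform g U) ∂haarProbability (Site d L → G) :=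
  avgL_apply _ f U

/-- **The gauge average fixes the gauge-invariant observables.** -/
theorem gaugeAvgL_of_isGaugeInvariant {f : C(GaugeConfig d L G, ℝ)} (hf : IsGaugeInvariant (⇑f)) :
    gaugeAvgL d L G f = f :=
  avgL_of_invariant _ hf

/-- `A 1 = 1`. -/
@[simp] theorem gaugeAvgL_one : gaugeAvgL d L G 1 = 1 := avgL_one _

/-- **Gauge averages are gauge invariant.** -/
theorem isGaugeInvariant_gaugeAvgL (f : C(GaugeConfig d L G, ℝ)) :
    IsGaugeInvariant (⇑(gaugeAvgL d L G f)) :=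
  fun g U => avgL_act _ gaugeTransform_action.1 f g U

/-- The gauge average absorbs gauge transformations: `A (f ∘ (·)^g) = A f`. -/
theorem gaugeAvgL_comp_gaugeTransformCM (f : C(GaugeConfig d L G, ℝ)) (g : Site d L → G) :
    gaugeAvgL d L G (f.comp (gaugeTransformCM d L G g)) = gaugeAvgL d L G f :=
  avgL_comp_actCM _ gaugeTransform_action.1 f g

/-- Gauge-invariant factors come out: `A (f w) = (A f) w`. -/
theorem gaugeAvgL_mul_of_isGaugeInvariant (f : C(GaugeConfig d L G, ℝ))
    {w : C(GaugeConfig d L G, ℝ)} (hw : IsGaugeInvariant (⇑w)) :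
    gaugeAvgL d L G (f * w) = gaugeAvgL d L G f * w :=
  avgL_mul_of_invariant _ f hw

/-- **The gauge average of a polynomial observable is a polynomial observable.** -/
theorem gaugeAvgL_mem_polyAlgebra (r : LatticeRep G) {f : C(GaugeConfig d L G, ℝ)}
    (hf : f ∈ polyAlgebra (ι := Edge d L) r) : gaugeAvgL d L G f ∈ polyAlgebra (ι := Edge d L) r :=
  avgL_mem_polyAlgebra r _ (gaugeTransform_hgen r) hf

/-- **`ψ ∘ₗ A` is a gauge-invariant functional**, for every linear `ψ`. -/
theorem comp_gaugeAvgL_comp_gaugeTransformCM (ψ : C(GaugeConfig d L G, ℝ) →ₗ[ℝ] ℝ)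
    (f : C(GaugeConfig d L G, ℝ)) (g : Site d L → G) :
    (ψ ∘ₗ gaugeAvgL d L G) (f.comp (gaugeTransformCM d L G g)) = (ψ ∘ₗ gaugeAvgL d L G) f :=
  comp_avgL_comp_actCM _ gaugeTransform_action.1 ψ f g

/-- `ψ ∘ₗ A` agrees with `ψ` on gauge-invariant observables. -/
theorem comp_gaugeAvgL_apply_of_isGaugeInvariant (ψ : C(GaugeConfig d L G, ℝ) →ₗ[ℝ] ℝ)
    {f : C(GaugeConfig d L G, ℝ)} (hf : IsGaugeInvariant (⇑f)) : (ψ ∘ₗ gaugeAvgL d L G) f = ψ f :=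
  comp_avgL_apply_of_invariant _ ψ hf

/-- **`ψ ∘ₗ A` only depends on the gauge-invariant data of `ψ`.** -/
theorem comp_gaugeAvgL_eq_of_forall_isGaugeInvariant {ψ₁ ψ₂ : C(GaugeConfig d L G, ℝ) →ₗ[ℝ] ℝ}
    (h : ∀ g : C(GaugeConfig d L G, ℝ), IsGaugeInvariant (⇑g) → ψ₁ g = ψ₂ g) :
    ψ₁ ∘ₗ gaugeAvgL d L G = ψ₂ ∘ₗ gaugeAvgL d L G :=
  comp_avgL_eq_of_forall_invariant _ gaugeTransform_action.1 h

/-- ★ **A gauge-invariant linear functional does not see the gauge average on polynomials**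
(`φ (g ∘ (·)^h) = φ g` for polynomial `g`; no continuity assumed). -/
theorem apply_gaugeAvgL_of_invariant (r : LatticeRep G) (φ : C(GaugeConfig d L G, ℝ) →ₗ[ℝ] ℝ)
    (hφ : ∀ (h : Site d L → G), ∀ g ∈ polyAlgebra (ι := Edge d L) r,
      φ (g.comp (gaugeTransformCM d L G h)) = φ g)
    {f : C(GaugeConfig d L G, ℝ)} (hf : f ∈ polyAlgebra (ι := Edge d L) r) :
    φ (gaugeAvgL d L G f) = φ f :=
  apply_avgL_of_invariant_poly r _ (gaugeTransform_hgen r) φ hφ hf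

variable {K : Type*} {k : K → ℝ → G} {S : Edge d L → GaugeConfig d L G → ℝ} {β : ℝ}

/-- ★★ **For a gauge-invariant functional, the gauge-averaged rows ARE the full rows**:
`IsSDFunctional (φ ∘ₗ A) ↔ IsSDFunctional φ`. -/
theorem isSDFunctional_comp_gaugeAvgL_iff (r : LatticeRep G) (φ : C(GaugeConfig d L G, ℝ) →ₗ[ℝ] ℝ)
    (hφ : ∀ (h : Site d L → G), ∀ g ∈ polyAlgebra (ι := Edge d L) r,
      φ (g.comp (gaugeTransformCM d L G h)) = φ g) :
    IsSDFunctional r k S β (φ ∘ₗ gaugeAvgL d L G) ↔ IsSDFunctional r k S β φ :=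
  isSDFunctional_congr r fun a ha => by
    rw [LinearMap.comp_apply, apply_gaugeAvgL_of_invariant r φ hφ ha]

/-- **…and the gauge-averaged positivity IS square-positivity** on the polynomials. -/
theorem sqPositive_comp_gaugeAvgL_iff (r : LatticeRep G) (φ : C(GaugeConfig d L G, ℝ) →ₗ[ℝ] ℝ)
    (hφ : ∀ (h : Site d L → G), ∀ g ∈ polyAlgebra (ι := Edge d L) r,
      φ (g.comp (gaugeTransformCM d L G h)) = φ g) :
    (∀ a ∈ polyAlgebra (ι := Edge d L) r, 0 ≤ φ (gaugeAvgL d L G (a * a))) ↔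
      ∀ a ∈ polyAlgebra (ι := Edge d L) r, 0 ≤ φ (a * a) :=
  forall₂_congr fun a ha => by
    rw [apply_gaugeAvgL_of_invariant r φ hφ ((polyAlgebra (ι := Edge d L) r).mul_mem ha ha)]

variable {N : ℕ} (ρ : G →* Matrix (Fin N) (Fin N) ℂ)

/-- **The Wilson state does not see the gauge average**: `E_Wilson ∘ₗ A = E_Wilson` (gauge
invariance of Wilson's measure, `wilsonMeasure_map_gaugeTransform_holds`). -/
theorem expectationFunctional_comp_gaugeAvgL_of_eq_wilson (β : ℝ) (μ : Measure (GaugeConfig d L G))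
    [IsFiniteMeasure μ] (hμ : μ = wilsonMeasure ρ β) :
    expectationFunctional μ ∘ₗ gaugeAvgL d L G = expectationFunctional μ :=
  expectationFunctional_comp_avgL _ μ fun g => by
    rw [hμ]
    exact wilsonMeasure_map_gaugeTransform_holds (d := d) (L := L) ρ β g

end Torus

/-! ## `SU(N)` and `U(N)` on the torus: the bootstrap on gauge-invariant data is exact -/

section Unitary

open Literature.MathematicalPhysics.QuantumFieldTheory (Site Edge GaugeConfig IsGaugeInvariant
  wilsonAction wilsonMeasure)
open Literature.MathematicalPhysics.QuantumLattice

variable {d L : ℕ}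

/-- ★★★ **`SU(N)` on `(ℤ/L)^d`, ANY real `β`: the gauge-invariant extension of a solution of the
bootstrap on gauge-invariant data IS the Wilson expectation.** `ψ` linear with `ψ 1 = 1`,
(P_G) `0 ≤ ψ (A (a a))` for all polynomial (open-string) `a` — Wilson-line / loop positivity —
and (SD_G) the gauge-averaged loop equations `ψ (A f') = β ψ (A (f S'))` for all polynomial test
functions (`IsSDFunctional … (ψ ∘ₗ A)`; multi-trace Makeenko–Migdal): then
`ψ (A a) = ∫ a dμ_Wilson` for EVERY polynomial observable `a`. [folklore] -/
theorem comp_gaugeAvgL_eq_wilson_suN [NeZero L] (N : ℕ) (β : ℝ)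
    {ψ : C(GaugeConfig d L (Matrix.specialUnitaryGroup (Fin N) ℂ), ℝ) →ₗ[ℝ] ℝ} (h1 : ψ 1 = 1)
    (hpos : ∀ a ∈ polyAlgebra (ι := Edge d L) (fundamentalLatticeRep N),
      0 ≤ ψ (gaugeAvgL d L _ (a * a)))
    (hψ : IsSDFunctional (fundamentalLatticeRep N) (suExp N)
      (fun _ => wilsonAction (fundamentalRep (Fin N))) β (ψ ∘ₗ gaugeAvgL d L _))
    {a : C(GaugeConfig d L (Matrix.specialUnitaryGroup (Fin N) ℂ), ℝ)}
    (ha : a ∈ polyAlgebra (ι := Edge d L) (fundamentalLatticeRep N)) :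
    ψ (gaugeAvgL d L _ a) = ∫ U, a U ∂(wilsonMeasure (fundamentalRep (Fin N)) β) :=
  eq_wilson_of_bootstrap_suN N β (φ := ψ ∘ₗ gaugeAvgL d L _)
    (by rw [LinearMap.comp_apply, gaugeAvgL_one, h1]) (fun a ha => hpos a ha) hψ ha

/-- ★★★ **`SU(N)` on `(ℤ/L)^d`, ANY real `β`: the lattice bootstrap on GAUGE-INVARIANT DATA is
exact** — normalisation, loop positivity (P_G) and the gauge-averaged loop equations (SD_G) give
every gauge-invariant polynomial observable its Wilson expectation. No realisability. [folklore] -/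
theorem eq_wilson_of_gaugeInvariantBootstrap_suN [NeZero L] (N : ℕ) (β : ℝ)
    {ψ : C(GaugeConfig d L (Matrix.specialUnitaryGroup (Fin N) ℂ), ℝ) →ₗ[ℝ] ℝ} (h1 : ψ 1 = 1)
    (hpos : ∀ a ∈ polyAlgebra (ι := Edge d L) (fundamentalLatticeRep N),
      0 ≤ ψ (gaugeAvgL d L _ (a * a)))
    (hψ : IsSDFunctional (fundamentalLatticeRep N) (suExp N)
      (fun _ => wilsonAction (fundamentalRep (Fin N))) β (ψ ∘ₗ gaugeAvgL d L _))
    {a : C(GaugeConfig d L (Matrix.specialUnitaryGroup (Fin N) ℂ), ℝ)}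
    (ha : a ∈ polyAlgebra (ι := Edge d L) (fundamentalLatticeRep N)) (hai : IsGaugeInvariant (⇑a)) :
    ψ a = ∫ U, a U ∂(wilsonMeasure (fundamentalRep (Fin N)) β) := by
  have h := comp_gaugeAvgL_eq_wilson_suN N β h1 hpos hψ ha
  rwa [gaugeAvgL_of_isGaugeInvariant hai] at h

/-- **Conversely the Wilson expectations solve the bootstrap on gauge-invariant data** (`SU(N)`,
torus; `μ` = Wilson's measure). [folklore] -/
theorem gaugeInvariantBootstrap_wilson_suN [NeZero L] (N : ℕ) (β : ℝ)
    (μ : Measure (GaugeConfig d L (Matrix.specialUnitaryGroup (Fin N) ℂ))) [IsProbabilityMeasure μ]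
    (hμ : μ = wilsonMeasure (fundamentalRep (Fin N)) β) :
    expectationFunctional μ 1 = 1 ∧
      (∀ a : C(GaugeConfig d L (Matrix.specialUnitaryGroup (Fin N) ℂ), ℝ),
        0 ≤ expectationFunctional μ (gaugeAvgL d L _ (a * a))) ∧
      IsSDFunctional (fundamentalLatticeRep N) (suExp N) (fun _ => wilsonAction (fundamentalRep (Fin N)))
        β (expectationFunctional μ ∘ₗ gaugeAvgL d L _) := by
  have hE := expectationFunctional_comp_gaugeAvgL_of_eq_wilson (fundamentalRep (Fin N)) β μ hμ
  obtain ⟨h1, hpos, hsd⟩ := bootstrap_wilson_suN (d := d) (L := L) N β μ hμ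
  refine ⟨h1, fun a => ?_, by rwa [hE]⟩
  have h := hpos a
  rw [← hE] at h
  exact h

/-- ★★ **For a gauge-invariant functional the bootstrap on gauge-invariant data and the
all-polynomial bootstrap are the same problem** (`SU(N)`, torus). [folklore] -/
theorem gaugeInvariantBootstrap_iff_of_invariant_suN [NeZero L] (N : ℕ) (β : ℝ)
    (φ : C(GaugeConfig d L (Matrix.specialUnitaryGroup (Fin N) ℂ), ℝ) →ₗ[ℝ] ℝ)
    (hφ : ∀ (h : Site d L → Matrix.specialUnitaryGroup (Fin N) ℂ),
      ∀ g ∈ polyAlgebra (ι := Edge d L) (fundamentalLatticeRep N),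
        φ (g.comp (gaugeTransformCM d L _ h)) = φ g) :
    ((∀ a ∈ polyAlgebra (ι := Edge d L) (fundamentalLatticeRep N),
        0 ≤ φ (gaugeAvgL d L _ (a * a))) ∧
      IsSDFunctional (fundamentalLatticeRep N) (suExp N)
        (fun _ => wilsonAction (fundamentalRep (Fin N))) β (φ ∘ₗ gaugeAvgL d L _)) ↔
    ((∀ a ∈ polyAlgebra (ι := Edge d L) (fundamentalLatticeRep N), 0 ≤ φ (a * a)) ∧
      IsSDFunctional (fundamentalLatticeRep N) (suExp N)
        (fun _ => wilsonAction (fundamentalRep (Fin N))) β φ) :=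
  and_congr (sqPositive_comp_gaugeAvgL_iff _ φ hφ) (isSDFunctional_comp_gaugeAvgL_iff _ φ hφ)

/-- ★★★ **`U(N)` on `(ℤ/L)^d`, ANY real `β`: the gauge-invariant extension of a solution of the
bootstrap on gauge-invariant data is the Wilson expectation.** [folklore] -/
theorem comp_gaugeAvgL_eq_wilson_uN [NeZero L] (N : ℕ) (β : ℝ)
    {ψ : C(GaugeConfig d L (Matrix.unitaryGroup (Fin N) ℂ), ℝ) →ₗ[ℝ] ℝ} (h1 : ψ 1 = 1)
    (hpos : ∀ a ∈ polyAlgebra (ι := Edge d L) (unitaryFundamentalLatticeRep N),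
      0 ≤ ψ (gaugeAvgL d L _ (a * a)))
    (hψ : IsSDFunctional (unitaryFundamentalLatticeRep N) (uExp N)
      (fun _ => wilsonAction (unitaryFundamentalRep (Fin N) ℂ)) β (ψ ∘ₗ gaugeAvgL d L _))
    {a : C(GaugeConfig d L (Matrix.unitaryGroup (Fin N) ℂ), ℝ)}
    (ha : a ∈ polyAlgebra (ι := Edge d L) (unitaryFundamentalLatticeRep N)) :
    ψ (gaugeAvgL d L _ a) = ∫ U, a U ∂(wilsonMeasure (unitaryFundamentalRep (Fin N) ℂ) β) :=
  eq_wilson_of_bootstrap_uN N β (φ := ψ ∘ₗ gaugeAvgL d L _)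
    (by rw [LinearMap.comp_apply, gaugeAvgL_one, h1]) (fun a ha => hpos a ha) hψ ha

/-- ★★★ **`U(N)` on `(ℤ/L)^d`, ANY real `β`: the bootstrap on gauge-invariant data is exact.**
[folklore] -/
theorem eq_wilson_of_gaugeInvariantBootstrap_uN [NeZero L] (N : ℕ) (β : ℝ)
    {ψ : C(GaugeConfig d L (Matrix.unitaryGroup (Fin N) ℂ), ℝ) →ₗ[ℝ] ℝ} (h1 : ψ 1 = 1)
    (hpos : ∀ a ∈ polyAlgebra (ι := Edge d L) (unitaryFundamentalLatticeRep N),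
      0 ≤ ψ (gaugeAvgL d L _ (a * a)))
    (hψ : IsSDFunctional (unitaryFundamentalLatticeRep N) (uExp N)
      (fun _ => wilsonAction (unitaryFundamentalRep (Fin N) ℂ)) β (ψ ∘ₗ gaugeAvgL d L _))
    {a : C(GaugeConfig d L (Matrix.unitaryGroup (Fin N) ℂ), ℝ)}
    (ha : a ∈ polyAlgebra (ι := Edge d L) (unitaryFundamentalLatticeRep N))
    (hai : IsGaugeInvariant (⇑a)) :
    ψ a = ∫ U, a U ∂(wilsonMeasure (unitaryFundamentalRep (Fin N) ℂ) β) := by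
  have h := comp_gaugeAvgL_eq_wilson_uN N β h1 hpos hψ ha
  rwa [gaugeAvgL_of_isGaugeInvariant hai] at h

end Unitary

/-! ## `ℤ^d`: solutions are DLR on the gauge-invariant polynomials -/

section Zd

open Literature.MathematicalPhysics.QuantumLattice
open Literature.Probability.LatticeModels (Site)

variable (d : ℕ) (G : Type*) [Group G] [TopologicalSpace G] [IsTopologicalGroup G]
  [CompactSpace G] [MeasurableSpace G] [BorelSpace G] [SecondCountableTopology G]

/-- **The gauge average on `ℤ^d`** over the compact gauge group `ℤ^d → G` (product Haar
probability), as a linear self-map of the observables. [folklore] -/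
def gaugeAvgZdL : C(LGConfig d G, ℝ) →ₗ[ℝ] C(LGConfig d G, ℝ) :=
  avgL (gaugeTransformZd (d := d) (G := G)) gaugeTransformZd_action.2

variable {d G}

/-- `gaugeAvgZdL` evaluated. -/
theorem gaugeAvgZdL_apply (f : C(LGConfig d G, ℝ)) (U : LGConfig d G) :
    gaugeAvgZdL d G f U = ∫ g, f (gaugeTransformZd g U) ∂haarProbability (Site d → G) :=
  avgL_apply _ f U

/-- The `ℤ^d` gauge average fixes the gauge-invariant observables. -/
theorem gaugeAvgZdL_of_isZdGaugeInvariant {f : C(LGConfig d G, ℝ)} (hf : IsZdGaugeInvariant (⇑f)) :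
    gaugeAvgZdL d G f = f :=
  avgL_of_invariant _ hf

/-- `ℤ^d` gauge averages are gauge invariant. -/
theorem isZdGaugeInvariant_gaugeAvgZdL (f : C(LGConfig d G, ℝ)) :
    IsZdGaugeInvariant (⇑(gaugeAvgZdL d G f)) :=
  fun g U => avgL_act _ gaugeTransformZd_action.1 f g U

/-- The `ℤ^d` gauge average of a (local) polynomial observable is a polynomial observable. -/
theorem gaugeAvgZdL_mem_polyAlgebra (r : LatticeRep G) {f : C(LGConfig d G, ℝ)}
    (hf : f ∈ polyAlgebra (ι := ZdEdge d) r) : gaugeAvgZdL d G f ∈ polyAlgebra (ι := ZdEdge d) r :=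
  avgL_mem_polyAlgebra r _ (gaugeTransformZd_hgen r) hf

/-- ★★ **`SU(N)` on `ℤ^d`, ANY real `β`: the gauge-invariant extension `ψ ∘ₗ A` of a solution of
the bootstrap on gauge-invariant data is a DLR expectation functional on the polynomials.** [folklore] -/
theorem exists_dlr_of_gaugeInvariantBootstrap_suN (N : ℕ) (β : ℝ)
    {ψ : C(LGConfig d (Matrix.specialUnitaryGroup (Fin N) ℂ), ℝ) →ₗ[ℝ] ℝ} (h1 : ψ 1 = 1)
    (hpos : ∀ a ∈ polyAlgebra (ι := ZdEdge d) (fundamentalLatticeRep N),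
      0 ≤ ψ (gaugeAvgZdL d _ (a * a)))
    (hψ : IsSDFunctional (fundamentalLatticeRep N) (suExp N)
      (fun e => wilsonBoundaryAction (fundamentalRep (Fin N)) {e}) β (ψ ∘ₗ gaugeAvgZdL d _)) :
    ∃ μ ∈ ymGibbsMeasures (d := d) (fundamentalRep (Fin N)) β,
      (∀ a ∈ polyAlgebra (ι := ZdEdge d) (fundamentalLatticeRep N),
          ψ (gaugeAvgZdL d _ a) = ∫ U, a U ∂μ) ∧
        ∀ a ∈ polyAlgebra (ι := ZdEdge d) (fundamentalLatticeRep N), IsZdGaugeInvariant (⇑a) →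
          ψ a = ∫ U, a U ∂μ := by
  obtain ⟨μ, hμ, hψμ⟩ := exists_dlr_of_bootstrap_suN (d := d) N β (φ := ψ ∘ₗ gaugeAvgZdL d _)
    (by rw [LinearMap.comp_apply, gaugeAvgZdL, avgL_one, h1]) (fun a ha => hpos a ha) hψ
  refine ⟨μ, hμ, fun a ha => hψμ a ha, fun a ha hai => ?_⟩
  rw [← hψμ a ha, LinearMap.comp_apply, gaugeAvgZdL_of_isZdGaugeInvariant hai]

/-- ★★ **`U(N)` on `ℤ^d`**: the same. [folklore] -/
theorem exists_dlr_of_gaugeInvariantBootstrap_uN (N : ℕ) (β : ℝ)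
    {ψ : C(LGConfig d (Matrix.unitaryGroup (Fin N) ℂ), ℝ) →ₗ[ℝ] ℝ} (h1 : ψ 1 = 1)
    (hpos : ∀ a ∈ polyAlgebra (ι := ZdEdge d) (unitaryFundamentalLatticeRep N),
      0 ≤ ψ (gaugeAvgZdL d _ (a * a)))
    (hψ : IsSDFunctional (unitaryFundamentalLatticeRep N) (uExp N)
      (fun e => wilsonBoundaryAction (unitaryFundamentalRep (Fin N) ℂ) {e}) β
      (ψ ∘ₗ gaugeAvgZdL d _)) :
    ∃ μ ∈ ymGibbsMeasures (d := d) (unitaryFundamentalRep (Fin N) ℂ) β,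
      (∀ a ∈ polyAlgebra (ι := ZdEdge d) (unitaryFundamentalLatticeRep N),
          ψ (gaugeAvgZdL d _ a) = ∫ U, a U ∂μ) ∧
        ∀ a ∈ polyAlgebra (ι := ZdEdge d) (unitaryFundamentalLatticeRep N), IsZdGaugeInvariant (⇑a) →
          ψ a = ∫ U, a U ∂μ := by
  obtain ⟨μ, hμ, hψμ⟩ := exists_dlr_of_bootstrap_uN (d := d) N β (φ := ψ ∘ₗ gaugeAvgZdL d _)
    (by rw [LinearMap.comp_apply, gaugeAvgZdL, avgL_one, h1]) (fun a ha => hpos a ha) hψ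
  refine ⟨μ, hμ, fun a ha => hψμ a ha, fun a ha hai => ?_⟩
  rw [← hψμ a ha, LinearMap.comp_apply, gaugeAvgZdL_of_isZdGaugeInvariant hai]

end Zd

end Summit.QuantumFields.GaugeBoot

end
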